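import Summits.BirchSwinnertonDyer.BirchSwinnertonDyer.Theorems.SemiOrdinaryEisensteinDescentShaTwoCochainIdeleDescent
import Literature.NumberTheory.GaloisRepresentations.HomDualShaTwoConnecting
import HarnessLib

/-!
# The Ш²-cochain bridge, step S3b (idèle side): the local classes `(π_v)_* res_v [Z]` of an ARBITRARY continuous idèle
# `2`-cocycle `Z` of `Γ_K` are read off ONE layer cocycle `b ∈ Z²(Gal(E/K), J_E)` — Brauer invariant `localInv E v [b]` at every
# finite place, vanishing `↔ localInvInf E w [b] = 0` at every infinite place — so that their sum is `inv E [b] = classInvAll K E (ε[b])`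
# (Tate, C–F VII §7.3 Cor. 7.4 (b), §11.2 (bis); Milne ADT I Thm. 4.10 (a), proof p. 58)

Route `SemiOrdinaryEisensteinDescent` (BSD, rung W-ALL row 2·3@3), Kolyvagin column, Cassels–Tate lane: print item
`CasselsTateLevelInputsFact` (stmt-BirchSwinnertonDyer-20191), whose one remaining input for THE canonical invariant maps is `hPTc`
(Milne I Thm. 4.10 (a) in `PTChoice` cochain form, p628097).  Sequel of `…ShaTwoCochainIdeleDescent` (S3a, p640146: descent of a
continuous `2`-cocycle of `Γ_K` in `lim→ S_E` to a layer cocycle on the nose, and the finite-place dictionary for ONE cocycle with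
layer values).  This file finishes the `J̄`-side of step S3 of the memo `Cruxes/WildKolyvaginUpperAtThree/SHA2-BRIDGE-w3g7.md` §1 (vi)
for an ARBITRARY continuous idèle `2`-cocycle `Z` (such as w3 g7's bridge cocycle `Z = B − H`, p634550 `bridgeCocycle_mem`), with THE
idèle projections `IdeleReadout.ideleProjection K v` of door-c6:

* §1 `exists_localIdeleCocycle` / `twoCocycleClass_eq_localIdeleClass` (finite `v`), `…_inf` (infinite `w`) — the local class
  `(π_v)_* res_v [Z] ∈ H²(K_v, K̄_vˣ)` as `cohomologyMap (π_v) ∘ galoisCohomology.res` on classes, with the cocycle formula: it is the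
  class of ANY continuous `2`-cocycle `c` of `Γ_{K_v}` with `c(s, t) = π_v Z(res_v s, res_v t)` (so it depends on `[Z]` only).
* §2 `brauerInvariant_eq_localInv_of_descended`, `twoCocycleClass_eq_zero_iff_localInvInf_of_descended` and the package
  **`exists_galLayer_localInvariants`**: for every `x ∈ H²_cont(Γ_K, J̄)` there are a layer `E` and `b ∈ Z²(Gal(E/K), J_E)` such that
  for EVERY representative `Z` of `x` and every such `c`: `inv_{K_v}[c] = localInv E v [b]` (finite `v`, `brauerInvariantEquiv`), and
  `[c] = 0 ↔ localInvInf E w [b] = 0` (infinite `w`).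
Consequently the local invariants of `x` are finitely supported and sum to `inv E [b]` (door-c5 `IdeleCohomology.inv_eq_sum_place`,
`exists_finset_placeComponent_eq_zero`) `= classInvAll K E (ideleToClass K E [b])` (door-c6 `classInvAll_ideleToClass`); the `C̄`-side of
S3 (that this number is determined by the continuous class of `j ∘ Z` in `H²_cont(Γ_K, C̄)`, `j : J̄ → C̄`, and equals road B's
`classBarInv` readout) is the remaining sequel.

THEOREMS ONLY (no definition, no instance, no instance attribute, no named fact, no `sorry`); `CompactSpace Γ_{K_w}` at an infinite
place is supplied by `haveI := absoluteGaloisGroup_compactSpace _` inside the statements (no `CharZero` instance on `w.Completion` is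
registered).  No case of BSD, of Poitou–Tate or of Cassels–Tate is proved here; BSD is not proved by any of this.
Width seat `bsd-wall-soed-p2-w2` g11; `--supports stmt-BirchSwinnertonDyer-20480`, helper.  Route-free.

## References
* [CasselsFrohlichANT1967] J. W. S. Cassels, A. Fröhlich (eds.), *Algebraic Number Theory* (1967), Ch. VII (J. Tate) §7.3 Cor. 7.4 (b),
  §11.2 (bis).
* [MilneADT2006] J. S. Milne, *Arithmetic Duality Theorems*, 2nd ed. (2006), I Lemma 4.13, Thm. 4.10 (a) (proof, p. 58), Ex. 1.6 (c).
* [SerreGaloisCohomology1997] J.-P. Serre, *Galois Cohomology* (1997), I §2.4 (functoriality on cochains).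
-/

noncomputable section

set_option linter.dupNamespace false
set_option autoImplicit false

namespace Summit.BirchSwinnertonDyer.BirchSwinnertonDyer.Theorems.ShaTwoCochain

open CategoryTheory groupCohomology Field NumberField IsDedekindDomain
open Literature.NumberTheory.GaloisRepresentations Literature.NumberTheory.GaloisRepresentations.IdeleClassBar
open Literature.NumberTheory.GaloisRepresentations.DGMBridge Literature.NumberTheory.GaloisRepresentations.LayerDelta
open Literature.Algebra.Homology Literature.Algebra.Homology.DiscreteRep
open scoped ContRepresentation

section IdeleSum

variable {K : Type} [Field K] [NumberField K] (E : GalLayer K)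


open HomDual IdeleReadout IdeleCohomology DiscreteGaloisModule
open Literature.NumberTheory.Automorphic
open Literature.AnabelianGeometry.AbsoluteAnabelian.Prop121vii (brauerInvariantEquiv)

/-- **The local idèle class at a finite place on cocycles.**  For an idèle projection `π_v : J̄ → K̄_vˣ` and a continuous
`2`-cocycle `Z` of `Γ_K` in `J̄`, the class `(π_v)_* res_v [Z] ∈ H²(K_v, K̄_vˣ)` is the class of a continuous `2`-cocycle with the
values `(s, t) ↦ π_v Z(res_v s, res_v t)` (Mathlib `ContinuousCohomology.map` on explicit cocycles; tree `res_twoCocycleClass`,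
`cohomologyMap_twoCocycleClass`). [cite: SerreGaloisCohomology1997, I §2.4][cite: MilneADT2006, I Lemma 4.13 (proof)] -/
theorem exists_localIdeleCocycle (v : HeightOneSpectrum (𝓞 K)) (π : IdeleProjection K (Sum.inr v))
    (Z : contTwoCocycles (toDGM (ideleBarD K)).toTopRep) :
    ∃ c : haveI := charZero_adicCompletion v; contTwoCocycles (units (v.adicCompletion K)).toTopRep,
      (haveI := charZero_adicCompletion v;
        cohomologyMap (toTopRepHom ((toDGM (ideleBarD K)).restrictField (v.adicCompletion K)) (units (v.adicCompletion K))
            π.toIntertwining) 2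
          (galoisCohomology.res (toDGM (ideleBarD K)) (v.adicCompletion K) 2 (twoCocycleClass (toDGM (ideleBarD K)).toTopRep Z)) =
        twoCocycleClass (units (v.adicCompletion K)).toTopRep c) ∧
      ∀ s t : absoluteGaloisGroup (v.adicCompletion K),
        c.1 (s, t) = π.toAddMonoidHom (LCarrier.val (ideleBarD K)
          (Z.1 (absGaloisRestrict K (v.adicCompletion K) s, absGaloisRestrict K (v.adicCompletion K) t))) := by
  haveI := charZero_adicCompletion v
  rw [galoisCohomology.res_twoCocycleClass, cohomologyMap_twoCocycleClass]
  exact ⟨_, rfl, fun s t => rfl⟩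

/-- **The local idèle class at a finite place, for ANY cocycle with the right values**: if `c(s, t) = π_v Z(res_v s, res_v t)` then
`[c] = (π_v)_* res_v [Z]`. [cite: SerreGaloisCohomology1997, I §2.4] -/
theorem twoCocycleClass_eq_localIdeleClass (v : HeightOneSpectrum (𝓞 K)) (π : IdeleProjection K (Sum.inr v))
    (Z : contTwoCocycles (toDGM (ideleBarD K)).toTopRep)
    (c : haveI := charZero_adicCompletion v; contTwoCocycles (units (v.adicCompletion K)).toTopRep)
    (hc : ∀ s t : absoluteGaloisGroup (v.adicCompletion K),
      c.1 (s, t) = π.toAddMonoidHom (LCarrier.val (ideleBarD K)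
        (Z.1 (absGaloisRestrict K (v.adicCompletion K) s, absGaloisRestrict K (v.adicCompletion K) t)))) :
    (haveI := charZero_adicCompletion v; twoCocycleClass (units (v.adicCompletion K)).toTopRep c) =
      (haveI := charZero_adicCompletion v;
        cohomologyMap (toTopRepHom ((toDGM (ideleBarD K)).restrictField (v.adicCompletion K)) (units (v.adicCompletion K))
            π.toIntertwining) 2
          (galoisCohomology.res (toDGM (ideleBarD K)) (v.adicCompletion K) 2 (twoCocycleClass (toDGM (ideleBarD K)).toTopRep Z))) := by
  haveI := charZero_adicCompletion v
  obtain ⟨c', hc', hv⟩ := exists_localIdeleCocycle v π Z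
  rw [hc']
  congr 1
  exact Subtype.ext (ContinuousMap.ext fun ⟨s, t⟩ => (hc s t).trans (hv s t).symm)

/-- **Finite places, from a descended representative.**  If `Z₀` represents `x ∈ H²_cont(Γ_K, J̄)` with values
`Z₀(σ, τ) = [b(σ|_E, τ|_E)]_E`, then for EVERY representative `Z` of `x`, every finite `v` and every continuous `2`-cocycle `c` of
`Γ_{K_v}` in `K̄_vˣ` with `c(s, t) = π_v Z(res_v s, res_v t)` (`π_v` THE idèle projection): `inv_{K_v}[c] = localInv E v [b]`
(well-definedness `twoCocycleClass_eq_localIdeleClass` + dictionary `brauerInvariantEquiv_twoCocycleClass_eq_localInv_canonical`).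
[cite: CasselsFrohlichANT1967, Ch. VII §7.3 Cor. 7.4 (b), §11.2][cite: MilneADT2006, I Lemma 4.13 (proof)] -/
theorem brauerInvariant_eq_localInv_of_descended {x : galoisCohomology (toDGM (ideleBarD K)) 2}
    {b : cocycles₂ ((ideleData K).obj E)} {Z₀ : contTwoCocycles (toDGM (ideleBarD K)).toTopRep}
    (hZ₀ : twoCocycleClass (toDGM (ideleBarD K)).toTopRep Z₀ = x)
    (hval : ∀ σ τ : absoluteGaloisGroup K,
      Z₀.1 (σ, τ) = LCarrier.of (ideleBarD K) ((ideleData K).toSystem.of E (b (E.restrictHom σ, E.restrictHom τ))))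
    (Z : contTwoCocycles (toDGM (ideleBarD K)).toTopRep) (hZ : twoCocycleClass (toDGM (ideleBarD K)).toTopRep Z = x)
    (v : HeightOneSpectrum (𝓞 K))
    (c : haveI := charZero_adicCompletion v; contTwoCocycles (units (v.adicCompletion K)).toTopRep)
    (hc : ∀ s t : absoluteGaloisGroup (v.adicCompletion K),
      c.1 (s, t) = (ideleProjection K (Sum.inr v)).toAddMonoidHom (LCarrier.val (ideleBarD K)
        (Z.1 (absGaloisRestrict K (v.adicCompletion K) s, absGaloisRestrict K (v.adicCompletion K) t)))) :
    (haveI := charZero_adicCompletion v;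
      brauerInvariantEquiv (v.adicCompletion K) (twoCocycleClass (units (v.adicCompletion K)).toTopRep c)) =
      (haveI := E.numberField; haveI := E.isGalois; localInv E.1 v (H2π (IdeleClassGroup.ideleRep K E.1) b)) := by
  haveI := charZero_adicCompletion v
  obtain ⟨c₀, hc₀, hv₀⟩ := exists_localIdeleCocycle v (ideleProjection K (Sum.inr v)) Z₀
  have hcc₀ : twoCocycleClass (units (v.adicCompletion K)).toTopRep c =
      twoCocycleClass (units (v.adicCompletion K)).toTopRep c₀ := by
    rw [twoCocycleClass_eq_localIdeleClass v (ideleProjection K (Sum.inr v)) Z c hc, hZ, ← hZ₀, hc₀]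
  -- (term-mode composition: `rw [hcc₀]` here elaborates but its cast blows the final check of the declaration)
  exact (congrArg (brauerInvariantEquiv (v.adicCompletion K)) hcc₀).trans
    (brauerInvariantEquiv_twoCocycleClass_eq_localInv_canonical E v b c₀ fun s t =>
      (hv₀ s t).trans (congrArg (fun z => (ideleProjection K (Sum.inr v)).toAddMonoidHom (LCarrier.val (ideleBarD K) z))
        (hval _ _)))

/-- **The local idèle class at an INFINITE place on cocycles**: `(π_w)_* res_w [Z]` is the class of a continuous `2`-cocycle with
the values `(s, t) ↦ π_w Z(res_w s, res_w t)`. [cite: SerreGaloisCohomology1997, I §2.4][cite: MilneADT2006, I Lemma 4.13 (proof)] -/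
theorem exists_localIdeleCocycle_inf (w : InfinitePlace K) (π : IdeleProjection K (Sum.inl w))
    (Z : contTwoCocycles (toDGM (ideleBarD K)).toTopRep) :
    haveI := absoluteGaloisGroup_compactSpace w.Completion
    ∃ c : contTwoCocycles (units w.Completion).toTopRep,
      cohomologyMap (toTopRepHom ((toDGM (ideleBarD K)).restrictField w.Completion) (units w.Completion) π.toIntertwining) 2
          (galoisCohomology.res (toDGM (ideleBarD K)) w.Completion 2 (twoCocycleClass (toDGM (ideleBarD K)).toTopRep Z)) =
        twoCocycleClass (units w.Completion).toTopRep c ∧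
      ∀ s t : absoluteGaloisGroup w.Completion,
        c.1 (s, t) = π.toAddMonoidHom (LCarrier.val (ideleBarD K)
          (Z.1 (absGaloisRestrict K w.Completion s, absGaloisRestrict K w.Completion t))) := by
  haveI := absoluteGaloisGroup_compactSpace w.Completion
  rw [galoisCohomology.res_twoCocycleClass, cohomologyMap_twoCocycleClass]
  exact ⟨_, rfl, fun s t => rfl⟩

/-- **The archimedean dictionary for the descended cocycle**: for a layer `E`, a `2`-cocycle `b` of `Gal(E/K)` in `J_E`, an idèle
projection `π_w` at an infinite place `w` reading the layer through door-c5's archimedean place readout (`hπ`; THE projection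
qualifies, `ideleProjection_inl_of`) and ANY continuous `2`-cocycle `c` of `Γ_{K_w}` in `K̄_wˣ` with `c(s, t) = π_w [b(s|_E, t|_E)]_E`:
`[c] = 0 ↔ localInvInf E w [b] = 0` (door-c5's `localInvInf_H2π_eq_zero_iff_readout`; `c` is the pull-back of `b` along the archimedean
readout pair on the nose). [cite: CasselsFrohlichANT1967, Ch. VII §7.3 Cor. 7.4 (b), §11.2][cite: MilneADT2006, I Ex. 1.6 (c)] -/
theorem twoCocycleClass_eq_zero_iff_localInvInf_eq_zero (w : InfinitePlace K) (π : IdeleProjection K (Sum.inl w))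
    (hπ : ∀ x : (ideleData K).V E, π.toAddMonoidHom ((ideleData K).toSystem.of E x) =
      (haveI := E.numberField; haveI := E.isGalois; ideleInfPlaceReadout w (layerEmb E) x))
    (b : cocycles₂ ((ideleData K).obj E)) (c : contTwoCocycles (units w.Completion).toTopRep)
    (hc : ∀ s t : absoluteGaloisGroup w.Completion,
      c.1 (s, t) = π.toAddMonoidHom ((ideleData K).toSystem.of E
        (b (E.restrictHom (absGaloisRestrict K w.Completion s), E.restrictHom (absGaloisRestrict K w.Completion t))))) :
    (haveI := absoluteGaloisGroup_compactSpace w.Completion; twoCocycleClass (units w.Completion).toTopRep c = 0) ↔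
      (haveI := E.numberField; haveI := E.isGalois; localInvInf E.1 w (H2π (IdeleClassGroup.ideleRep K E.1) b)) = 0 := by
  haveI := E.numberField
  haveI := E.isGalois
  haveI := E.finiteDimensional
  haveI := absoluteGaloisGroup_compactSpace w.Completion
  have hcb : c = (archReadoutPair w (layerEmb E)).pull b := by
    refine Subtype.ext (ContinuousMap.ext fun st => ?_)
    obtain ⟨s, t⟩ := st
    rw [hc, CompatiblePair.pull_apply, archReadoutPair_f, archReadoutPair_f, archReadoutPair_φ, galRestrictField_layerEmb,
      galRestrictField_layerEmb]
    exact hπ _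
  rw [hcb]
  exact (localInvInf_H2π_eq_zero_iff_readout w (layerEmb E) b).symm

/-- The class of a local cocycle with prescribed values at an infinite place is `(π_w)_* res_w [Z]`.
[cite: SerreGaloisCohomology1997, I §2.4] -/
theorem twoCocycleClass_eq_localIdeleClass_inf (w : InfinitePlace K) (π : IdeleProjection K (Sum.inl w))
    (Z : contTwoCocycles (toDGM (ideleBarD K)).toTopRep) (c : contTwoCocycles (units w.Completion).toTopRep)
    (hc : ∀ s t : absoluteGaloisGroup w.Completion,
      c.1 (s, t) = π.toAddMonoidHom (LCarrier.val (ideleBarD K)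
        (Z.1 (absGaloisRestrict K w.Completion s, absGaloisRestrict K w.Completion t)))) :
    haveI := absoluteGaloisGroup_compactSpace w.Completion
    twoCocycleClass (units w.Completion).toTopRep c =
      cohomologyMap (toTopRepHom ((toDGM (ideleBarD K)).restrictField w.Completion) (units w.Completion) π.toIntertwining) 2
        (galoisCohomology.res (toDGM (ideleBarD K)) w.Completion 2 (twoCocycleClass (toDGM (ideleBarD K)).toTopRep Z)) := by
  haveI := absoluteGaloisGroup_compactSpace w.Completion
  obtain ⟨c', hc', hv'⟩ := exists_localIdeleCocycle_inf w π Z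
  rw [hc']
  congr 1
  exact Subtype.ext (ContinuousMap.ext fun ⟨s, t⟩ => (hc s t).trans (hv' s t).symm)

/-- **Infinite places, from a descended representative**: the archimedean twin of `brauerInvariant_eq_localInv_of_descended`
(`[c] = 0 ↔ localInvInf E w [b] = 0`). [cite: CasselsFrohlichANT1967, Ch. VII §7.3 Cor. 7.4 (b)][cite: MilneADT2006, I Ex. 1.6 (c)] -/
theorem twoCocycleClass_eq_zero_iff_localInvInf_of_descended {x : galoisCohomology (toDGM (ideleBarD K)) 2}
    {b : cocycles₂ ((ideleData K).obj E)} {Z₀ : contTwoCocycles (toDGM (ideleBarD K)).toTopRep}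
    (hZ₀ : twoCocycleClass (toDGM (ideleBarD K)).toTopRep Z₀ = x)
    (hval : ∀ σ τ : absoluteGaloisGroup K,
      Z₀.1 (σ, τ) = LCarrier.of (ideleBarD K) ((ideleData K).toSystem.of E (b (E.restrictHom σ, E.restrictHom τ))))
    (Z : contTwoCocycles (toDGM (ideleBarD K)).toTopRep) (hZ : twoCocycleClass (toDGM (ideleBarD K)).toTopRep Z = x)
    (w : InfinitePlace K) (c : contTwoCocycles (units w.Completion).toTopRep)
    (hc : ∀ s t : absoluteGaloisGroup w.Completion,
      c.1 (s, t) = (ideleProjection K (Sum.inl w)).toAddMonoidHom (LCarrier.val (ideleBarD K)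
        (Z.1 (absGaloisRestrict K w.Completion s, absGaloisRestrict K w.Completion t)))) :
    (haveI := absoluteGaloisGroup_compactSpace w.Completion; twoCocycleClass (units w.Completion).toTopRep c = 0) ↔
      (haveI := E.numberField; haveI := E.isGalois; localInvInf E.1 w (H2π (IdeleClassGroup.ideleRep K E.1) b)) = 0 := by
  haveI := absoluteGaloisGroup_compactSpace w.Completion
  obtain ⟨c₀, hc₀, hv₀⟩ := exists_localIdeleCocycle_inf w (ideleProjection K (Sum.inl w)) Z₀
  have hcc₀ : twoCocycleClass (units w.Completion).toTopRep c = twoCocycleClass (units w.Completion).toTopRep c₀ := by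
    rw [twoCocycleClass_eq_localIdeleClass_inf w (ideleProjection K (Sum.inl w)) Z c hc, hZ, ← hZ₀, hc₀]
  exact (Eq.congr_left hcc₀).trans
    (twoCocycleClass_eq_zero_iff_localInvInf_eq_zero E w (ideleProjection K (Sum.inl w)) (ideleProjection_inl_of w E) b c₀
      fun s t => (hv₀ s t).trans (congrArg (fun z => (ideleProjection K (Sum.inl w)).toAddMonoidHom
        (LCarrier.val (ideleBarD K) z)) (hval _ _)))

/-- **S3 for an arbitrary continuous idèle `2`-cocycle (all places).**  Every class `x ∈ H²_cont(Γ_K, J̄)` has a layer `E` and a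
`2`-cocycle `b` of `Gal(E/K)` in `J_E` (one descended representative, `exists_galLayer_cocycle_eq_twoCocycleClass`) such that, for EVERY
representative `Z` of `x` and the local cocycles `c` read off `Z` through THE idèle projections: at every finite place
`inv_{K_v}[c] = localInv E v [b]`, and at every infinite place `[c] = 0 ↔ localInvInf E w [b] = 0`.  Hence the sum of the local
invariants of `x` over any finite set of places carrying them is `inv E [b] = classInvAll K E (ideleToClass [b])` (door-c5
`IdeleCohomology.inv_eq_sum_place`, door-c6 `classInvAll_ideleToClass`) — the `J̄`-side of memo §1 (vi).
[cite: CasselsFrohlichANT1967, Ch. VII §7.3 Cor. 7.4 (b), §11.2 (bis)][cite: MilneADT2006, I Thm. 4.10 (a) (proof, p. 58), Lemma 4.13] -/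
theorem exists_galLayer_localInvariants (x : galoisCohomology (toDGM (ideleBarD K)) 2) :
    ∃ (E : GalLayer K) (b : cocycles₂ ((ideleData K).obj E)),
      (∀ Z : contTwoCocycles (toDGM (ideleBarD K)).toTopRep, twoCocycleClass (toDGM (ideleBarD K)).toTopRep Z = x →
        ∀ (v : HeightOneSpectrum (𝓞 K))
          (c : haveI := charZero_adicCompletion v; contTwoCocycles (units (v.adicCompletion K)).toTopRep),
          (∀ s t : absoluteGaloisGroup (v.adicCompletion K),
            c.1 (s, t) = (ideleProjection K (Sum.inr v)).toAddMonoidHom (LCarrier.val (ideleBarD K)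
              (Z.1 (absGaloisRestrict K (v.adicCompletion K) s, absGaloisRestrict K (v.adicCompletion K) t)))) →
          (haveI := charZero_adicCompletion v;
            brauerInvariantEquiv (v.adicCompletion K) (twoCocycleClass (units (v.adicCompletion K)).toTopRep c)) =
            (haveI := E.numberField; haveI := E.isGalois; localInv E.1 v (H2π (IdeleClassGroup.ideleRep K E.1) b))) ∧
      (∀ Z : contTwoCocycles (toDGM (ideleBarD K)).toTopRep, twoCocycleClass (toDGM (ideleBarD K)).toTopRep Z = x →
        ∀ (w : InfinitePlace K) (c : contTwoCocycles (units w.Completion).toTopRep),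
          (∀ s t : absoluteGaloisGroup w.Completion,
            c.1 (s, t) = (ideleProjection K (Sum.inl w)).toAddMonoidHom (LCarrier.val (ideleBarD K)
              (Z.1 (absGaloisRestrict K w.Completion s, absGaloisRestrict K w.Completion t)))) →
          ((haveI := absoluteGaloisGroup_compactSpace w.Completion; twoCocycleClass (units w.Completion).toTopRep c = 0) ↔
            (haveI := E.numberField; haveI := E.isGalois; localInvInf E.1 w (H2π (IdeleClassGroup.ideleRep K E.1) b)) = 0)) := by
  obtain ⟨E, b, Z₀, hZ₀, hval⟩ := exists_galLayer_cocycle_eq_twoCocycleClass (ideleData K) x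
  haveI : Normal K E.1 := normal_layer E
  exact ⟨E, b, brauerInvariant_eq_localInv_of_descended E hZ₀ hval, twoCocycleClass_eq_zero_iff_localInvInf_of_descended E hZ₀ hval⟩

end IdeleSum

end Summit.BirchSwinnertonDyer.BirchSwinnertonDyer.Theorems.ShaTwoCochain

end
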